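import Mathlib
import Summits.AtomisticToContinuum.Crystallization.Theorems.ChessboardParticlePlanesLjLaminarWindowsGlueC5
import Summits.AtomisticToContinuum.Crystallization.Theorems.ChessboardParticlePlanesLjLaminarWindowsMassBoundA
import HarnessLib

/-! # NSF reduction — stub `stub_nsfReduction` of line `Sketch` (skeleton rev. 14, lead c8), crux
`LjLaminarWindows` (stmt-AtomisticToContinuum-6711)

The non-spiky-fraction statement NSF at a single scale `L` is assembled from the conclusions of
Stage A (mass bound `M₁ L` on `2L`-balls inside an all-spiky `2L²`-region, hypothesis `hMB`) and
Stage B (an all-spiky `L`-neighbourhood with a `2L`-ball of mass `≤ M₁ L` and a far particle is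
impossible, hypothesis `hSP`).  With `ϱ = 2L² + 2L`, `W = (2ϱ/(7/10) + 1)³`, `δ = 1/(2W)` and
`N₀ = ⌈M₁ L⌉₊ + 1`: if fewer than `δ N` particles were non-spiky, the `ϱ`-balls around them would hold
fewer than `N/2` particles (packing at separation `7/10`), so some particle `p₀` has an all-spiky
`ϱ`-neighbourhood; Stage A bounds its `2L`-ball by `M₁ L < N`, whence a particle beyond `2L`, and
Stage B yields the contradiction. -/

noncomputable section

open scoped BigOperators
open Filter Topology
open Literature.MathematicalPhysics.StatisticalMechanics
open Summit.AtomisticToContinuum.Crystallization.Theorems.ChargedEnergyGapNegative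

namespace Summit.AtomisticToContinuum.Crystallization.Theorems.LjLaminarWindowsSketch

/-- **NSF reduction (stub `stub_nsfReduction` of line `Sketch`, lead c8).** The non-spiky-fraction
statement NSF from Stage A (`hMB`) and Stage B (`hSP`): with `δ = 1/(2 (2(2L²+2L)/(7/10) + 1)³)` and
`N₀ = ⌈M₁ L⌉₊ + 1 > M₁ L`, if fewer than `δ N` particles were non-spiky then some particle `p₀` would
have no non-spiky particle within `2L² + 2L` (packing), Stage A would bound the `2L`-ball at `p₀` by
`M₁ L < N` (so a far particle exists), and Stage B would give a contradiction. [folklore] -/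
theorem stub_nsfReduction
    (hMB : ∀ θ R : ℝ, 0 < θ → θ < 1 → 1 ≤ R → ∃ M₁ L₁ : ℝ, 0 < M₁ ∧ ∀ L : ℝ, L₁ ≤ L →
      ∀ (N : ℕ) (x : Fin N → E3),
      (∀ j k : Fin N, j ≠ k → (7 : ℝ) / 10 ≤ dist (x j) (x k)) →
      (∀ S : Finset (Fin N), S.Nonempty → Sᶜ.Nonempty →
          ∃ p ∈ S, ∃ k ∈ Sᶜ, dist (x p) (x k) ≤ 23 / 20) →
      ∀ p₀ : Fin N,
        (∀ p : Fin N, dist (x p) (x p₀) ≤ 2 * L ^ 2 →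
          θ * ((Finset.univ.filter fun q : Fin N => dist (x q) (x p) ≤ L).card : ℝ) <
            ((Finset.univ.filter fun q : Fin N =>
              L - R < dist (x q) (x p) ∧ dist (x q) (x p) ≤ L).card : ℝ)) →
        ∀ q : Fin N, dist (x q) (x p₀) ≤ L ^ 2 →
          ((Finset.univ.filter fun j : Fin N => dist (x j) (x q) ≤ 2 * L).card : ℝ) ≤ M₁ * L)
    (hSP : ∀ θ R M₁ : ℝ, 0 < θ → θ < 1 → 1 ≤ R → 0 < M₁ → ∃ L₂ : ℝ, ∀ L : ℝ, L₂ ≤ L →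
      ∀ (N : ℕ) (x : Fin N → E3),
      (∀ j k : Fin N, j ≠ k → (7 : ℝ) / 10 ≤ dist (x j) (x k)) →
      (∀ S : Finset (Fin N), S.Nonempty → Sᶜ.Nonempty →
          ∃ p ∈ S, ∃ k ∈ Sᶜ, dist (x p) (x k) ≤ 23 / 20) →
      ∀ a : Fin N,
        (∀ p : Fin N, dist (x p) (x a) ≤ L →
          θ * ((Finset.univ.filter fun q : Fin N => dist (x q) (x p) ≤ L).card : ℝ) <
            ((Finset.univ.filter fun q : Fin N =>
              L - R < dist (x q) (x p) ∧ dist (x q) (x p) ≤ L).card : ℝ)) →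
        ((Finset.univ.filter fun j : Fin N => dist (x j) (x a) ≤ 2 * L).card : ℝ) ≤ M₁ * L →
        (∃ j : Fin N, 2 * L < dist (x j) (x a)) → False) :
    ∀ θ R : ℝ, 0 < θ → θ < 1 → 1 ≤ R → ∃ L₀ : ℝ, ∀ L : ℝ, L₀ ≤ L → ∃ δ : ℝ, 0 < δ ∧ ∃ N₀ : ℕ,
      ∀ N : ℕ, N₀ ≤ N → ∀ x : Fin N → E3,
      (∀ j k : Fin N, j ≠ k → (7 : ℝ) / 10 ≤ dist (x j) (x k)) →
      (∀ S : Finset (Fin N), S.Nonempty → Sᶜ.Nonempty →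
          ∃ p ∈ S, ∃ k ∈ Sᶜ, dist (x p) (x k) ≤ 23 / 20) →
      δ * (N : ℝ) ≤ ((Finset.univ.filter fun i : Fin N =>
        ((Finset.univ.filter fun q : Fin N =>
            L - R < dist (x q) (x i) ∧ dist (x q) (x i) ≤ L).card : ℝ) ≤
          θ * ((Finset.univ.filter fun q : Fin N => dist (x q) (x i) ≤ L).card : ℝ)).card : ℝ) := by
  intro θ R hθ hθ1 hR
  obtain ⟨M₁, L₁, hM₁, hA⟩ := hMB θ R hθ hθ1 hR
  obtain ⟨L₂, hB⟩ := hSP θ R M₁ hθ hθ1 hR hM₁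
  refine ⟨max (max L₁ L₂) 1, fun L hL => ?_⟩
  have hL₁ : L₁ ≤ L := le_trans (le_trans (le_max_left L₁ L₂) (le_max_left _ 1)) hL
  have hL₂ : L₂ ≤ L := le_trans (le_trans (le_max_right L₁ L₂) (le_max_left _ 1)) hL
  have hL1 : 1 ≤ L := le_trans (le_max_right _ 1) hL
  -- the radius `ϱ = 2L² + 2L` of the protected neighbourhood and the packing number `W` of a `ϱ`-ball
  set ϱ : ℝ := 2 * L ^ 2 + 2 * L with hϱ
  have hϱ0 : 0 ≤ ϱ := by positivity
  have hLϱ : L ≤ ϱ := by nlinarith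
  have hL2ϱ : 2 * L ^ 2 ≤ ϱ := by nlinarith
  set W : ℝ := (2 * ϱ / (7 / 10) + 1) ^ 3 with hW
  have hW0 : 0 < W := by positivity
  refine ⟨1 / (2 * W), by positivity, ⌈M₁ * L⌉₊ + 1, fun N hN x hsep hconn => ?_⟩
  have hinj : Function.Injective x := massBound_injective x hsep
  have hNreal : (⌈M₁ * L⌉₊ : ℝ) + 1 ≤ (N : ℝ) := by exact_mod_cast hN
  have hML : M₁ * L < (N : ℝ) :=
    lt_of_lt_of_le (lt_of_le_of_lt (Nat.le_ceil _) (lt_add_one _)) hNreal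
  -- the non-spiky particles
  set B : Finset (Fin N) := Finset.univ.filter fun i : Fin N =>
      ((Finset.univ.filter fun q : Fin N =>
          L - R < dist (x q) (x i) ∧ dist (x q) (x i) ≤ L).card : ℝ) ≤
        θ * ((Finset.univ.filter fun q : Fin N => dist (x q) (x i) ≤ L).card : ℝ) with hBdef
  by_contra hlt
  rw [not_le] at hlt
  -- the `ϱ`-neighbourhood of the non-spiky particles misses some particle `p₀`
  have hcover : (((B.biUnion fun i : Fin N =>
      Finset.univ.filter fun p : Fin N => dist (x p) (x i) ≤ ϱ).card : ℕ) : ℝ) < (N : ℝ) := by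
    have h1 : (((B.biUnion fun i : Fin N =>
        Finset.univ.filter fun p : Fin N => dist (x p) (x i) ≤ ϱ).card : ℕ) : ℝ) ≤
        ∑ i ∈ B, ((Finset.univ.filter fun p : Fin N => dist (x p) (x i) ≤ ϱ).card : ℝ) := by
      exact_mod_cast Finset.card_biUnion_le
    have h2 : ∑ i ∈ B, ((Finset.univ.filter fun p : Fin N => dist (x p) (x i) ≤ ϱ).card : ℝ) ≤
        ∑ _i ∈ B, W :=
      Finset.sum_le_sum fun i _ =>
        glue_ball_card_le N x hinj (by norm_num : (0 : ℝ) < 7 / 10) hsep (x i) hϱ0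
    rw [Finset.sum_const, nsmul_eq_mul] at h2
    have h3 : (B.card : ℝ) * W < 1 / (2 * W) * (N : ℝ) * W := mul_lt_mul_of_pos_right hlt hW0
    have h4 : 1 / (2 * W) * (N : ℝ) * W = (N : ℝ) / 2 := by
      field_simp
    have h5 : (0 : ℝ) ≤ (N : ℝ) := Nat.cast_nonneg N
    linarith
  have hcover' : (B.biUnion fun i : Fin N =>
      Finset.univ.filter fun p : Fin N => dist (x p) (x i) ≤ ϱ).card <
      (Finset.univ : Finset (Fin N)).card := by
    rw [Finset.card_univ, Fintype.card_fin]
    exact_mod_cast hcover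
  obtain ⟨p₀, -, hp₀⟩ := Finset.exists_mem_notMem_of_card_lt_card hcover'
  -- every particle within `ϱ` of `p₀` is spiky
  have hspiky : ∀ p : Fin N, dist (x p) (x p₀) ≤ ϱ →
      θ * ((Finset.univ.filter fun q : Fin N => dist (x q) (x p) ≤ L).card : ℝ) <
        ((Finset.univ.filter fun q : Fin N =>
          L - R < dist (x q) (x p) ∧ dist (x q) (x p) ≤ L).card : ℝ) := by
    intro p hp
    by_contra hns
    rw [not_lt] at hns
    have hpB : p ∈ B := by
      rw [hBdef, Finset.mem_filter]
      exact ⟨Finset.mem_univ _, hns⟩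
    apply hp₀
    rw [Finset.mem_biUnion]
    refine ⟨p, hpB, ?_⟩
    rw [Finset.mem_filter, dist_comm]
    exact ⟨Finset.mem_univ _, hp⟩
  -- Stage A: the `2L`-ball of `p₀` holds at most `M₁ L < N` particles, so a far particle exists
  have hball : ((Finset.univ.filter fun j : Fin N => dist (x j) (x p₀) ≤ 2 * L).card : ℝ) ≤
      M₁ * L :=
    hA L hL₁ N x hsep hconn p₀ (fun p hp => hspiky p (le_trans hp hL2ϱ)) p₀
      (by rw [dist_self]; positivity)
  have hball' : (Finset.univ.filter fun j : Fin N => dist (x j) (x p₀) ≤ 2 * L).card <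
      (Finset.univ : Finset (Fin N)).card := by
    rw [Finset.card_univ, Fintype.card_fin]
    exact_mod_cast lt_of_le_of_lt hball hML
  obtain ⟨j, -, hj⟩ := Finset.exists_mem_notMem_of_card_lt_card hball'
  have hj' : 2 * L < dist (x j) (x p₀) := by
    rw [Finset.mem_filter, not_and] at hj
    exact lt_of_not_ge (hj (Finset.mem_univ _))
  -- Stage B: contradiction
  exact hB L hL₂ N x hsep hconn p₀ (fun p hp => hspiky p (le_trans hp hLϱ)) hball ⟨j, hj'⟩

end Summit.AtomisticToContinuum.Crystallization.Theorems.LjLaminarWindowsSketch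

end
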